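import Summits.PneNP.PneNP.Theses.KarlinRubin
import Summits.PneNP.PneNP.Theorems.KarlinRubinMonotoneSufficesOneNegation

/-!
# Witness of weakness for the rung `OneNegElim` (crux `MonotoneSuffices`, stmt-PneNP-18026, line `negation-ladder`)

Self-contained F3 / BC5 witness file (`Lines/OneNegElim_special.lean`): the graded rung `OneNegElimOn 𝒢`
(one-negation elimination at polynomial cost for negated monotone gates in the class `𝒢`, average case over
`G(n,1/2)` versus planted clique at `k = ⌈n^{1/2-δ}⌉`) is PROVED for the class `NonCoin` of gates that are
asymptotically not two-sided coins (`min(μ₀{g = 1}, μ₁{g = 0}) → 0`), with exponent `a = 1`, from the landed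
theorem `Summit.PneNP.PneNP.Theorems.MonotoneSuffices.Compression.stub_oneNegation` (p160305: freeze the
negation wire to the better constant / keep the better branch `D(·,0)` or `D(·,1)`).

The definitions `OneNegElimOn`, `NonCoin` are verbatim copies of those in the line skeleton
`Lines/negation_ladder.lean` (namespace `…Cruxes.MonotoneSuffices.NegationLadder`); the rung itself is
`OneNegElimOn (fun _ _ => True)` = `Summit.PneNP.PneNP.Cruxes.MonotoneSuffices.DecompositionAudit.OneNegElim`,
and the open residue is the complementary class `Coin := ¬ NonCoin`.

Why this rung-case lies outside the summit's known regime: it is an unconditional average-case SIMULATION theorem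
for one-negation detector families at clique size `n^{1/2-δ}` — a regime where neither `PneNP` nor the crux
`MonotoneSuffices` nor any monotone/general lower bound for planted clique is known; it exercises the line's lever
(negation-wire freezing under the two product-type laws), not a consequence of `P ≠ NP`.

No `sorry`.
-/

set_option linter.dupNamespace false

namespace Summit.PneNP.PneNP.Cruxes.MonotoneSuffices.NegationLadderSpecial

open Filter Topology
open scoped ENNReal Classical
open Literature.Computability.Complexity Literature.Probability.RandomGraphs.PlantedClique
open Summit.PneNP.PneNP.Theorems

/-- Graded rung (copy of `NegationLadder.OneNegElimOn`): one-negation elimination at polynomial cost for negated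
gates in the class `𝒢`. -/
def OneNegElimOn (𝒢 : ℝ → ((n : ℕ) → Circuit ((⊤ : SimpleGraph (Fin n)).edgeSet)) → Prop) : Prop :=
  ∀ δ : ℝ, 0 < δ → δ < 1 / 2 → ∃ a : ℕ, ∀ s : ℕ → ℕ,
    ∀ (D : (n : ℕ) → Circuit ((⊤ : SimpleGraph (Fin n)).edgeSet ⊕ Unit))
      (g : (n : ℕ) → Circuit ((⊤ : SimpleGraph (Fin n)).edgeSet)),
      𝒢 δ g →
      (∀ᶠ n : ℕ in atTop, (D n).IsOver monotoneBasis01 ∧ (g n).IsOver monotoneBasis01 ∧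
        (D n).size + (g n).size ≤ s n) →
      Tendsto (fun n : ℕ =>
          (erdosRenyiHalf n).toOuterMeasure
              {x | (D n).eval (Sum.elim x (fun _ => !((g n).eval x))) = true} +
            (plantedCliqueDist n ⌈(n : ℝ) ^ (1 / 2 - δ)⌉₊).toOuterMeasure
              {x | (D n).eval (Sum.elim x (fun _ => !((g n).eval x))) = false})
        atTop (nhds 0) →
      ∃ C' : (n : ℕ) → Circuit ((⊤ : SimpleGraph (Fin n)).edgeSet),
        (∀ᶠ n : ℕ in atTop, (C' n).IsOver monotoneBasis01 ∧ (C' n).size ≤ (s n + n) ^ a) ∧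
          Tendsto (fun n : ℕ =>
            (erdosRenyiHalf n).toOuterMeasure {x | (C' n).eval x = true} +
              (plantedCliqueDist n ⌈(n : ℝ) ^ (1 / 2 - δ)⌉₊).toOuterMeasure {x | (C' n).eval x = false})
            atTop (nhds 0)

/-- The negated gate family is asymptotically NOT a two-sided coin (copy of `NegationLadder.NonCoin`). -/
def NonCoin (δ : ℝ) (g : (n : ℕ) → Circuit ((⊤ : SimpleGraph (Fin n)).edgeSet)) : Prop :=
  Tendsto (fun n : ℕ => min ((erdosRenyiHalf n).toOuterMeasure {x | (g n).eval x = true})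
      ((plantedCliqueDist n ⌈(n : ℝ) ^ (1 / 2 - δ)⌉₊).toOuterMeasure {x | (g n).eval x = false}))
    atTop (nhds 0)

/-- **Rung special case (F3 witness): `OneNegElimOn NonCoin`**, exponent `a = 1`, from the landed
`MonotoneSuffices.Compression.stub_oneNegation` (p160305). [folklore] -/
theorem OneNegElim_special : OneNegElimOn NonCoin := by
  intro δ hδ hδ'
  refine ⟨1, fun s D g hg hDg hT => ?_⟩
  obtain ⟨M, hM, hMT⟩ := MonotoneSuffices.Compression.stub_oneNegation (fun n => ⌈(n : ℝ) ^ (1 / 2 - δ)⌉₊) s D g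
    (hDg.mono fun n h => ⟨h.1, h.2.1, le_of_add_le_left h.2.2⟩) hT hg
  refine ⟨M, ?_, hMT⟩
  filter_upwards [hM, eventually_ge_atTop 1] with n hn hn1
  exact ⟨hn.1, hn.2.trans (by rw [pow_one]; omega)⟩

end Summit.PneNP.PneNP.Cruxes.MonotoneSuffices.NegationLadderSpecial
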